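import Mathlib
import Summits.Ventures.PercRepro2.TypedResidualBase

/-!
# The reduction spine of row 2′TRI, II: the residual class `NR` and the spine theorem (blind cell
PercRepro2, p2 g0, 2026-08-25; sub-claim S1, `proofs/subclaims/S1-REDUCTION.md`)

With the ingredients of `TypedResidualBase.lean` (the base `Base5U4`, the pinned-loop rule, the
reduction measure):

* **`Reduced`** — the typed graphs `(V, F)` to which NO rule of the typed reduction calculus
  applies (no typed loop / root pair / parallel pair, no unmarked vertex of typed degree one or
  two, neither `b` nor `o` of typed degree one); a residual instance is taken with every edge
  pinned closed (`z = fun _ => false`: the count does not see `z` on `F`, and off `F` the rules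
  have contracted the pinned-open non-loops and closed the pinned-open loops);
* **`Residual`** — the residual class `NR`: `Reduced`, at least SIX typed edges, and each of
  `a₁, a₂, o, b` of typed degree at least one (`a₃` exempt); `not_base5U4_of_residual`;
* **`typedCount_nonneg_of_residual`** — THE SPINE: (TRI) on `NR` gives (TRI) on every instance,
  by strong induction on `redMeasure`: each rule (`typedCount_contract_open`,
  `typedCount_pinned_loop`, `typedCount_root_pair`, `typedCount_loop`,
  `typedCount_unmarked_leaf'`, `typedCount_pendant_b'` / `_o'`, `typedCount_parallel`,
  `typedCount_series`) rewrites the count into nonnegative combinations of counts of smaller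
  measure; the base is `typedCount_nonneg_of_base5U4`; an instance reached by no rule and outside
  the base is residual (`exists_mem_ends_of_touches`);
* **`TypedBases_of_residual`**, **`typedBases_all_of_residual_all`**,
  **`HCov_all_of_residual_all`** — row 2′TRI and the crux of record `HCov_all` (DEMO-PACKET §(c))
  from (TRI) on `NR` alone; `residual_of_typedBases` is the trivial converse.

Own code; standard axioms; no `native_decide`.
-/

namespace Summit.Ventures.PercRepro2

open UnionCluster

namespace CovForm

namespace TypedRed

open Contract Untouched

/-! ## The fully reduced instances and the residual class -/

section Residual

variable {V : Type*} {E : Type*} [DecidableEq V] [Fintype E] [DecidableEq E]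

/-- **Fully reduced**: no rule of the typed reduction calculus applies to the typed graph
`(V, F)` — no typed loop, no typed root pair, no parallel typed pair, no unmarked vertex of typed
degree one (rule (c′)) or two (rule (a)), neither `b` nor `o` of typed degree one (rule (d′)). -/
structure Reduced (ends : E → Sym2 V) (o a₁ a₂ a₃ b : V) (F : Finset E) : Prop where
  /-- no typed edge joins the two roots -/
  no_root_pair : ∀ f ∈ F, ends f ≠ s(a₁, a₂)
  /-- no typed loop -/
  no_loop : ∀ f ∈ F, ¬ (ends f).IsDiag
  /-- no parallel typed pair (rule (b)) -/
  no_parallel : ∀ e ∈ F, ∀ f ∈ F, e ≠ f → ends e ≠ ends f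
  /-- no unmarked typed leaf (rule (c′)): an unmarked end of a typed edge carries another typed
  edge -/
  no_leaf : ∀ f ∈ F, ∀ l u : V, ends f = s(l, u) → l ≠ u → l ≠ o → l ≠ a₁ → l ≠ a₂ → l ≠ a₃ →
    l ≠ b → ∃ e' ∈ F, e' ≠ f ∧ l ∈ ends e'
  /-- no pendant typed `b` (rule (d′)) -/
  no_pendant_b : ∀ f ∈ F, ∀ u : V, ends f = s(b, u) → b ≠ u → b ≠ o → b ≠ a₁ → b ≠ a₂ →
    b ≠ a₃ → ∃ e' ∈ F, e' ≠ f ∧ b ∈ ends e'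
  /-- no pendant typed `o` (rule (d′)) -/
  no_pendant_o : ∀ f ∈ F, ∀ u : V, ends f = s(o, u) → o ≠ u → o ≠ a₁ → o ≠ a₂ → o ≠ a₃ →
    o ≠ b → ∃ e' ∈ F, e' ≠ f ∧ o ∈ ends e'
  /-- no unmarked vertex of typed degree two (rule (a)) -/
  no_series : ∀ e ∈ F, ∀ f ∈ F, e ≠ f → ∀ u w v : V, ends e = s(u, w) → ends f = s(w, v) →
    w ≠ u → w ≠ v → w ≠ o → w ≠ a₁ → w ≠ a₂ → w ≠ a₃ → w ≠ b →
    ∃ e' ∈ F, e' ≠ e ∧ e' ≠ f ∧ w ∈ ends e'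

/-- **The residual class `NR`** of sub-claim S1: fully reduced, at least six typed edges, and each
of the four marks `a₁, a₂, o, b` of typed degree at least one (`a₃` is exempt). -/
structure Residual (ends : E → Sym2 V) (o a₁ a₂ a₃ b : V) (F : Finset E) : Prop where
  reduced : Reduced ends o a₁ a₂ a₃ b F
  six_le : 6 ≤ F.card
  deg_a1 : ∃ e ∈ F, a₁ ∈ ends e
  deg_a2 : ∃ e ∈ F, a₂ ∈ ends e
  deg_o : ∃ e ∈ F, o ∈ ends e
  deg_b : ∃ e ∈ F, b ∈ ends e

omit [DecidableEq V] [Fintype E] [DecidableEq E] in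
/-- With every edge off `F` pinned closed, a typed edge touching the pinned cluster of `v` yields
a typed edge at `v` itself (the first open edge of a path from `v` is typed). -/
lemma exists_mem_ends_of_touches {ends : E → Sym2 V} {F : Finset E} {z : Config E}
    (hz : ∀ g, g ∉ F → z g = false) {v : V} {e : E} (heF : e ∈ F)
    (ht : e ∈ touches ends (cluster ends z v)) : ∃ e' ∈ F, v ∈ ends e' := by
  obtain ⟨x, hx, y, hxy⟩ := ht
  rw [mem_cluster] at hx
  let S : Set V := {w | w = v ∨ ∃ e' ∈ F, v ∈ ends e'}
  have hS : ∀ w ∈ S, ∀ w', (openGraph ends z).Adj w w' → w' ∈ S := by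
    intro w hw w' hww'
    obtain ⟨_, e', he', hends⟩ := openGraph_adj.1 hww'
    rcases hw with hw | hw
    · refine Or.inr ⟨e', ?_, ?_⟩
      · by_contra hF
        rw [hz e' hF] at he'
        exact Bool.false_ne_true he'
      · rw [hends, ← hw]
        exact Sym2.mem_mk_left _ _
    · exact Or.inr hw
  have hxS : x ∈ S := mem_of_conn_of_closed hS (Or.inl rfl) hx
  rcases hxS with hxv | h
  · refine ⟨e, heF, ?_⟩
    rw [hxy, ← hxv]
    exact Sym2.mem_mk_left _ _
  · exact h

omit [DecidableEq V] [Fintype E] [DecidableEq E] in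
/-- A residual instance is not in the base (with every edge pinned closed). -/
theorem not_base5U4_of_residual {ends : E → Sym2 V} {o a₁ a₂ a₃ b : V} {F : Finset E}
    (τ : E → ℕ) (h : Residual ends o a₁ a₂ a₃ b F) :
    ¬ Base5U4 ends o a₁ a₂ a₃ b F (fun _ => false) τ := by
  have key : ∀ v : V, (∃ e ∈ F, v ∈ ends e) → ¬ UntouchedBy ends F (fun _ => false) v := by
    rintro v ⟨e, he, hv⟩ hU
    refine hU e he ⟨v, mem_cluster_self ends _ v, ?_⟩
    obtain ⟨y, hy⟩ := Sym2.mem_iff_exists.1 hv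
    exact ⟨y, hy⟩
  rintro (h5 | h1 | h2 | ho | hb)
  · have := h.six_le; omega
  · exact key a₁ h.deg_a1 h1
  · exact key a₂ h.deg_a2 h2
  · exact key o h.deg_o ho
  · exact key b h.deg_b hb

variable {R : Type*} [Field R] [LinearOrder R] [IsStrictOrderedRing R]

/-- **THE REDUCTION SPINE (sub-claim S1)**: if row 2′TRI holds on the residual class `NR`, it holds
on every instance — by strong induction on the reduction measure, each rule of the calculus
(contraction, pinned loop, root pair, typed loop, unmarked leaf, pendant `b` / `o`, parallel,
series) rewriting the typed count by its landed identity into counts of smaller measure, and the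
base `Base5U4` discharged by `FiveTypedAll` and the untouched-mark vanishing theorems. -/
theorem typedCount_nonneg_of_residual
    (hNR : ∀ (ends : E → Sym2 V) (o a₁ a₂ a₃ b : V) (F : Finset E) (τ : E → ℕ),
      (∀ e ∈ F, τ e = 1 ∨ τ e = 2) → Residual ends o a₁ a₂ a₃ b F →
        0 ≤ typedCount F (fun _ => false) τ
          (K3 ends o a₁ a₂ a₃ b : Config E → Config E → Config E → R))
    (ends : E → Sym2 V) (o a₁ a₂ a₃ b : V) (F : Finset E) (z : Config E) (τ : E → ℕ)
    (hτ : ∀ e ∈ F, τ e = 1 ∨ τ e = 2) :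
    0 ≤ typedCount F z τ (K3 ends o a₁ a₂ a₃ b : Config E → Config E → Config E → R) := by
  generalize hn : redMeasure ends F z = n
  induction n using Nat.strong_induction_on generalizing ends o a₁ a₂ a₃ b F z τ with
  | _ n ih =>
  -- the base, then the rules in the order contraction, pinned loop, root pair, typed loop,
  -- unmarked leaf, pendant `b`, pendant `o`, parallel, series; last the residual case
  by_cases hB : Base5U4 ends o a₁ a₂ a₃ b F z τ
  · exact typedCount_nonneg_of_base5U4 ends o a₁ a₂ a₃ b F z τ hB hτ
  by_cases hc : ∃ g, g ∉ F ∧ z g = true ∧ ¬ (ends g).IsDiag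
  · obtain ⟨g, hgF, hz, hnd⟩ := hc
    obtain ⟨⟨u, v⟩, huv⟩ := Quot.exists_rep (ends g)
    have hg : ends g = s(u, v) := huv.symm
    have huv' : u ≠ v := by
      intro h
      apply hnd
      rw [hg, Sym2.mk_isDiag_iff]
      exact h
    rw [typedCount_contract_open ends o a₁ a₂ a₃ b hg F hgF z hz τ]
    exact ih _ (by rw [← hn]; exact redMeasure_contract_lt ends hg huv' hgF hz) _ _ _ _ _ _ F z τ
      hτ rfl
  by_cases hl : ∃ g, g ∉ F ∧ z g = true ∧ (ends g).IsDiag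
  · obtain ⟨g, hgF, hz, hd⟩ := hl
    obtain ⟨⟨u, v⟩, huv⟩ := Quot.exists_rep (ends g)
    have hg : ends g = s(u, v) := huv.symm
    have huv' : u = v := by
      rw [hg, Sym2.mk_isDiag_iff] at hd
      exact hd
    subst huv'
    rw [typedCount_pinned_loop ends o a₁ a₂ a₃ b hg F hgF z hz τ]
    exact ih _ (by rw [← hn]; exact redMeasure_update_closed_lt ends hgF hz) _ _ _ _ _ _ F _ τ
      hτ rfl
  by_cases hr : ∃ f ∈ F, ends f = s(a₁, a₂)
  · obtain ⟨f, hfF, hf⟩ := hr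
    have h1 : 1 ≤ τ f := by rcases hτ f hfF with h | h <;> omega
    rw [typedCount_root_pair ends o a₁ a₂ a₃ b hf F hfF z τ h1]
  by_cases htl : ∃ f ∈ F, (ends f).IsDiag
  · obtain ⟨f, hfF, hd⟩ := htl
    obtain ⟨⟨u, v⟩, huv⟩ := Quot.exists_rep (ends f)
    have hf : ends f = s(u, v) := huv.symm
    have huv' : u = v := by
      rw [hf, Sym2.mk_isDiag_iff] at hd
      exact hd
    subst huv'
    rw [typedCount_loop ends o a₁ a₂ a₃ b hf F hfF z τ,
      typedCount_type_zero F _ hfF z _ (Function.update_self _ _ _),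
      typedCount_congr_τ (F.erase _) _ (τ' := τ)
        (fun e he => Function.update_of_ne (Finset.ne_of_mem_erase he) _ _)]
    exact mul_nonneg (Nat.cast_nonneg _)
      (ih _ (by rw [← hn]; exact redMeasure_erase_update_lt ends hfF z false) _ _ _ _ _ _ _ _ τ
        (fun e he => hτ e (Finset.mem_of_mem_erase he)) rfl)
  by_cases hleaf : ∃ f ∈ F, ∃ l u : V, ends f = s(l, u) ∧ l ≠ u ∧ l ≠ o ∧ l ≠ a₁ ∧ l ≠ a₂ ∧
      l ≠ a₃ ∧ l ≠ b ∧ (∀ e', e' ≠ f → l ∈ ends e' → e' ∉ F ∧ z e' = false)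
  · obtain ⟨f, hfF, l, u, hf, hlu, hlo, hl1, hl2, hl3, hlb, hcl⟩ := hleaf
    rw [typedCount_unmarked_leaf' ends o a₁ a₂ a₃ b hf hlu hlo hl1 hl2 hl3 hlb F hfF z τ hcl,
      typedCount_type_zero F _ hfF z _ (Function.update_self _ _ _),
      typedCount_congr_τ (F.erase _) _ (τ' := τ)
        (fun e he => Function.update_of_ne (Finset.ne_of_mem_erase he) _ _)]
    exact mul_nonneg (Nat.cast_nonneg _)
      (ih _ (by rw [← hn]; exact redMeasure_erase_update_lt ends hfF z false) _ _ _ _ _ _ _ _ τ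
        (fun e he => hτ e (Finset.mem_of_mem_erase he)) rfl)
  by_cases hpb : ∃ f ∈ F, ∃ u : V, ends f = s(b, u) ∧ b ≠ u ∧ b ≠ o ∧ b ≠ a₁ ∧ b ≠ a₂ ∧
      b ≠ a₃ ∧ (∀ e', e' ≠ f → b ∈ ends e' → e' ∉ F ∧ z e' = false)
  · obtain ⟨f, hfF, u, hf, hbu, hbo, hb1, hb2, hb3, hcl⟩ := hpb
    have h1 : 1 ≤ τ f := by rcases hτ f hfF with h | h <;> omega
    rw [typedCount_pendant_b' ends o a₁ a₂ a₃ b hf hbu hbo hb1 hb2 hb3 F hfF z τ h1 hcl,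
      typedCount_type_three F _ hfF z _ (Function.update_self _ _ _),
      typedCount_congr_τ (F.erase _) _ (τ' := τ)
        (fun e he => Function.update_of_ne (Finset.ne_of_mem_erase he) _ _)]
    exact mul_nonneg (Nat.cast_nonneg _)
      (ih _ (by rw [← hn]; exact redMeasure_erase_update_lt ends hfF z true) _ _ _ _ _ _ _ _ τ
        (fun e he => hτ e (Finset.mem_of_mem_erase he)) rfl)
  by_cases hpo : ∃ f ∈ F, ∃ u : V, ends f = s(o, u) ∧ o ≠ u ∧ o ≠ a₁ ∧ o ≠ a₂ ∧ o ≠ a₃ ∧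
      o ≠ b ∧ (∀ e', e' ≠ f → o ∈ ends e' → e' ∉ F ∧ z e' = false)
  · obtain ⟨f, hfF, u, hf, hou, ho1, ho2, ho3, hob, hcl⟩ := hpo
    have h1 : 1 ≤ τ f := by rcases hτ f hfF with h | h <;> omega
    rw [typedCount_pendant_o' ends o a₁ a₂ a₃ b hf hou ho1 ho2 ho3 hob F hfF z τ h1 hcl,
      typedCount_type_three F _ hfF z _ (Function.update_self _ _ _),
      typedCount_congr_τ (F.erase _) _ (τ' := τ)
        (fun e he => Function.update_of_ne (Finset.ne_of_mem_erase he) _ _)]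
    exact mul_nonneg (Nat.cast_nonneg _)
      (ih _ (by rw [← hn]; exact redMeasure_erase_update_lt ends hfF z true) _ _ _ _ _ _ _ _ τ
        (fun e he => hτ e (Finset.mem_of_mem_erase he)) rfl)
  by_cases hpar : ∃ e ∈ F, ∃ f ∈ F, e ≠ f ∧ ends e = ends f
  · obtain ⟨e, heF, f, hfF, hef, hpar⟩ := hpar
    have heF' : e ∈ F.erase f := Finset.mem_erase.2 ⟨hef, heF⟩
    rw [typedCount_parallel ends o a₁ a₂ a₃ b hef hpar F heF hfF z τ (hτ e heF) (hτ f hfF),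
      Finset.sum_range_succ, Finset.sum_range_succ, Finset.sum_range_succ, Finset.sum_range_succ,
      Finset.sum_range_zero, zero_add, muOr_zero _ _ (hτ e heF) (hτ f hfF), Nat.cast_zero, zero_mul,
      zero_add]
    have hτ' : ∀ j, ∀ e' ∈ F.erase f, e' ≠ e →
        Function.update τ e j e' = 1 ∨ Function.update τ e j e' = 2 := by
      intro j e' he' hne
      rw [Function.update_of_ne hne]
      exact hτ e' (Finset.mem_of_mem_erase he')
    have hlt1 : redMeasure ends (F.erase f) (Function.update z f false) < n := by
      rw [← hn]; exact redMeasure_erase_update_lt ends hfF z false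
    refine add_nonneg (add_nonneg (mul_nonneg (Nat.cast_nonneg _) ?_)
      (mul_nonneg (Nat.cast_nonneg _) ?_)) (mul_nonneg (Nat.cast_nonneg _) ?_)
    · refine ih _ hlt1 _ _ _ _ _ _ _ _ _ (fun e' he' => ?_) rfl
      by_cases hne : e' = e
      · subst hne; rw [Function.update_self]; exact Or.inl rfl
      · exact hτ' 1 e' he' hne
    · refine ih _ hlt1 _ _ _ _ _ _ _ _ _ (fun e' he' => ?_) rfl
      by_cases hne : e' = e
      · subst hne; rw [Function.update_self]; exact Or.inr rfl
      · exact hτ' 2 e' he' hne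
    · rw [typedCount_type_three (F.erase f) e heF' _ _ (Function.update_self _ _ _),
        typedCount_congr_τ ((F.erase f).erase e) _ (τ' := τ)
          (fun e' he' => Function.update_of_ne (Finset.ne_of_mem_erase he') _ _)]
      refine ih _ ?_ _ _ _ _ _ _ _ _ τ
        (fun e' he' => hτ e' (Finset.mem_of_mem_erase (Finset.mem_of_mem_erase he'))) rfl
      exact (redMeasure_erase_update_lt ends heF' _ true).trans hlt1
  by_cases hser : ∃ e ∈ F, ∃ f ∈ F, e ≠ f ∧ ∃ u w v : V, ends e = s(u, w) ∧ ends f = s(w, v) ∧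
      w ≠ u ∧ w ≠ v ∧ w ≠ o ∧ w ≠ a₁ ∧ w ≠ a₂ ∧ w ≠ a₃ ∧ w ≠ b ∧
      (∀ e', e' ≠ e → e' ≠ f → w ∈ ends e' → e' ∉ F ∧ z e' = false)
  · obtain ⟨e, heF, f, hfF, hef, u, w, v, he, hf, hwu, hwv, hwo, hw1, hw2, hw3, hwb, hcl⟩ := hser
    have heF' : e ∈ F.erase f := Finset.mem_erase.2 ⟨hef, heF⟩
    rw [typedCount_series ends o a₁ a₂ a₃ b hef he hf hwu hwv hwo hw1 hw2 hw3 hwb F heF hfF z τ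
        (hτ e heF) (hτ f hfF) hcl,
      Finset.sum_range_succ, Finset.sum_range_succ, Finset.sum_range_succ, Finset.sum_range_succ,
      Finset.sum_range_zero, zero_add, muAnd_three _ _ (hτ e heF) (hτ f hfF), Nat.cast_zero,
      zero_mul, add_zero]
    have hτ' : ∀ j, ∀ e' ∈ F.erase f, e' ≠ e →
        Function.update τ e j e' = 1 ∨ Function.update τ e j e' = 2 := by
      intro j e' he' hne
      rw [Function.update_of_ne hne]
      exact hτ e' (Finset.mem_of_mem_erase he')
    have hlt1 : redMeasure ends (F.erase f) (Function.update z f true) < n := by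
      rw [← hn]; exact redMeasure_erase_update_lt ends hfF z true
    refine add_nonneg (add_nonneg (mul_nonneg (Nat.cast_nonneg _) ?_)
      (mul_nonneg (Nat.cast_nonneg _) ?_)) (mul_nonneg (Nat.cast_nonneg _) ?_)
    · rw [typedCount_type_zero (F.erase f) e heF' _ _ (Function.update_self _ _ _),
        typedCount_congr_τ ((F.erase f).erase e) _ (τ' := τ)
          (fun e' he' => Function.update_of_ne (Finset.ne_of_mem_erase he') _ _)]
      refine ih _ ?_ _ _ _ _ _ _ _ _ τ
        (fun e' he' => hτ e' (Finset.mem_of_mem_erase (Finset.mem_of_mem_erase he'))) rfl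
      exact (redMeasure_erase_update_lt ends heF' _ false).trans hlt1
    · refine ih _ hlt1 _ _ _ _ _ _ _ _ _ (fun e' he' => ?_) rfl
      by_cases hne : e' = e
      · subst hne; rw [Function.update_self]; exact Or.inl rfl
      · exact hτ' 1 e' he' hne
    · refine ih _ hlt1 _ _ _ _ _ _ _ _ _ (fun e' he' => ?_) rfl
      by_cases hne : e' = e
      · subst hne; rw [Function.update_self]; exact Or.inr rfl
      · exact hτ' 2 e' he' hne
  -- no rule applies and the instance is not in the base: it is residual
  have hz0 : ∀ g, g ∉ F → z g = false := by
    intro g hgF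
    by_contra hz
    have hz' : z g = true := by
      cases h : z g
      · exact absurd h hz
      · rfl
    by_cases hd : (ends g).IsDiag
    · exact hl ⟨g, hgF, hz', hd⟩
    · exact hc ⟨g, hgF, hz', hd⟩
  have hRed : Reduced ends o a₁ a₂ a₃ b F :=
    { no_root_pair := fun f hfF hf => hr ⟨f, hfF, hf⟩
      no_loop := fun f hfF hd => htl ⟨f, hfF, hd⟩
      no_parallel := fun e heF f hfF hef hp => hpar ⟨e, heF, f, hfF, hef, hp⟩
      no_leaf := fun f hfF l u hf hlu hlo hl1 hl2 hl3 hlb => by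
        by_contra hno
        refine hleaf ⟨f, hfF, l, u, hf, hlu, hlo, hl1, hl2, hl3, hlb, fun e' hne hl' => ?_⟩
        have hnF : e' ∉ F := fun hF => hno ⟨e', hF, hne, hl'⟩
        exact ⟨hnF, hz0 e' hnF⟩
      no_pendant_b := fun f hfF u hf hbu hbo hb1 hb2 hb3 => by
        by_contra hno
        refine hpb ⟨f, hfF, u, hf, hbu, hbo, hb1, hb2, hb3, fun e' hne hb' => ?_⟩
        have hnF : e' ∉ F := fun hF => hno ⟨e', hF, hne, hb'⟩
        exact ⟨hnF, hz0 e' hnF⟩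
      no_pendant_o := fun f hfF u hf hou ho1 ho2 ho3 hob => by
        by_contra hno
        refine hpo ⟨f, hfF, u, hf, hou, ho1, ho2, ho3, hob, fun e' hne ho' => ?_⟩
        have hnF : e' ∉ F := fun hF => hno ⟨e', hF, hne, ho'⟩
        exact ⟨hnF, hz0 e' hnF⟩
      no_series := fun e heF f hfF hef u w v he hf hwu hwv hwo hw1 hw2 hw3 hwb => by
        by_contra hno
        refine hser ⟨e, heF, f, hfF, hef, u, w, v, he, hf, hwu, hwv, hwo, hw1, hw2, hw3, hwb,
          fun e' hne hnf hw' => ?_⟩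
        have hnF : e' ∉ F := fun hF => hno ⟨e', hF, hne, hnf, hw'⟩
        exact ⟨hnF, hz0 e' hnF⟩ }
  have hRes : Residual ends o a₁ a₂ a₃ b F := by
    have h5 : ¬ F.card ≤ 5 := fun h => hB (Or.inl h)
    have h1 : ¬ UntouchedBy ends F z a₁ := fun h => hB (Or.inr (Or.inl h))
    have h2 : ¬ UntouchedBy ends F z a₂ := fun h => hB (Or.inr (Or.inr (Or.inl h)))
    have ho : ¬ UntouchedBy ends F z o := fun h => hB (Or.inr (Or.inr (Or.inr (Or.inl h))))
    have hb : ¬ UntouchedBy ends F z b := fun h => hB (Or.inr (Or.inr (Or.inr (Or.inr h))))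
    have key : ∀ v : V, ¬ UntouchedBy ends F z v → ∃ e ∈ F, v ∈ ends e := by
      intro v hU
      by_contra hno
      exact hU fun e he ht => hno (exists_mem_ends_of_touches hz0 he ht)
    exact ⟨hRed, by omega, key a₁ h1, key a₂ h2, key o ho, key b hb⟩
  rw [typedCount_congr_z F (z' := fun _ => false) (fun e he => hz0 e he) τ]
  exact hNR ends o a₁ a₂ a₃ b F τ hτ hRes

/-- **`TypedBases` from (TRI) on the residual class** (the instances over the same vertex and
edge types). -/
theorem TypedBases_of_residual
    (hNR : ∀ (ends : E → Sym2 V) (o a₁ a₂ a₃ b : V) (F : Finset E) (τ : E → ℕ),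
      (∀ e ∈ F, τ e = 1 ∨ τ e = 2) → Residual ends o a₁ a₂ a₃ b F →
        0 ≤ typedCount F (fun _ => false) τ
          (K3 ends o a₁ a₂ a₃ b : Config E → Config E → Config E → R))
    (ends : E → Sym2 V) (o a₁ a₂ a₃ b : V) : TypedBases (R := R) ends o a₁ a₂ a₃ b :=
  fun F z τ hτ => typedCount_nonneg_of_residual hNR ends o a₁ a₂ a₃ b F z τ hτ

omit [DecidableEq V] [IsStrictOrderedRing R] in
/-- The converse: `TypedBases` restricted to the residual class. -/
theorem residual_of_typedBases {ends : E → Sym2 V} {o a₁ a₂ a₃ b : V}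
    (h : TypedBases (R := R) ends o a₁ a₂ a₃ b) (F : Finset E) (τ : E → ℕ)
    (hτ : ∀ e ∈ F, τ e = 1 ∨ τ e = 2) (_hres : Residual ends o a₁ a₂ a₃ b F) :
    0 ≤ typedCount F (fun _ => false) τ
      (K3 ends o a₁ a₂ a₃ b : Config E → Config E → Config E → R) :=
  h F (fun _ => false) τ hτ

end Residual

/-! ## The closures -/

section Closure

variable (R : Type*) [Field R] [LinearOrder R] [IsStrictOrderedRing R]

/-- **Row 2′TRI on the residual class `NR`, over every finite graph** (the open content of the
crux after sub-claim S1). -/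
def Residual_all : Prop :=
  ∀ (V E : Type) [Fintype V] [DecidableEq V] [Fintype E] [DecidableEq E]
    (ends : E → Sym2 V) (o a₁ a₂ a₃ b : V) (F : Finset E) (τ : E → ℕ),
    (∀ e ∈ F, τ e = 1 ∨ τ e = 2) → Residual ends o a₁ a₂ a₃ b F →
      0 ≤ typedCount F (fun _ => false) τ
        (K3 ends o a₁ a₂ a₃ b : Config E → Config E → Config E → R)

/-- **Row 2′TRI over every finite graph.** -/
def TypedBases_all : Prop :=
  ∀ (V E : Type) [Fintype V] [DecidableEq V] [Fintype E] [DecidableEq E]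
    (ends : E → Sym2 V) (o a₁ a₂ a₃ b : V), TypedBases (R := R) ends o a₁ a₂ a₃ b

/-- **(TRI) everywhere from (TRI) on `NR`.** -/
theorem typedBases_all_of_residual_all (h : Residual_all R) : TypedBases_all R := by
  intro V E _ _ _ _ ends o a₁ a₂ a₃ b
  exact TypedBases_of_residual (fun ends o a₁ a₂ a₃ b F τ hτ hres =>
    h V E ends o a₁ a₂ a₃ b F τ hτ hres) ends o a₁ a₂ a₃ b

/-- **The crux of record from (TRI) on the residual class**: `HCov_all` (DEMO-PACKET §(c)) follows
from row 2′TRI on `NR` alone. -/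
theorem HCov_all_of_residual_all (h : Residual_all R) : HCov_all R := by
  intro V E _ _ _ _ ends p hp o a₁ a₂ a₃ b _ _ _ _ _ _ _ _ _ _
  exact HCov_of_typedBases ends o a₁ a₂ a₃ b
    (typedBases_all_of_residual_all R h V E ends o a₁ a₂ a₃ b) p hp

end Closure

end TypedRed

end CovForm

end Summit.Ventures.PercRepro2
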